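import Summits.HodgeConjecture.CorCM.MultiFieldWeilTwinRealised
import Summits.HodgeConjecture.CorCM.MultiFieldWeilPrimeDegreesOutsideClosures
import Summits.HodgeConjecture.CorCM.SexticCMThreefoldPairPowersHodgeOfMarkman
import Summits.HodgeConjecture.CorCM.MultiFieldWeilTwoSimpleThreefolds
import Summits.HodgeConjecture.CorCM.MultiFieldWeilSimpleFamilies
import HarnessLib

/-!
# MULTI-FIELD WEIL ENGINE — SEXTIC TWINS: `E` + TWO TYPES `B, B^σ` OF ONE SEXTIC CM FIELD `K ∋ k` READ IN ONE FRAME + any number of further sextic CM fields through `k` outside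
# each other's (and `K`'s) Galois closures — the Hodge conjecture for every product of copies, given ONLY Markman's fourfold theorem (frame form for the twin pair)

Cell `pub-hodgecm2` (COR-CM), seat b30 gen 37 (2026-08-25); count-neutral own lane MULTI-FIELD WEIL ENGINE (stem `MultiFieldWeil*`), sequel of `CorCM/MultiFieldWeilTwinRealised.lean`
(T2: the frame-form headline with a twin pair) in the pattern of V2 §4 `hodgeConjectureFor_biproduct_comp_of_sextics_of_outside_closures`.  Theorems only; no definition, no named
fact, no `sorry`.  HONEST FRAMING: conditional ONLY on `Markman2025_weilClasses_algebraic_abelianFourfold`; `HC_CM` is NOT proved and not asserted.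

THE STATEMENT (**`hodgeConjectureFor_biproduct_comp_of_sexticTwins_of_outside_closures`**).  Slots `Fin (r+2)` over the fields `Fin.cons i₁ (Fin.cons i₁ is')`: the TWIN slots
`0`, `1` carry ONE sextic CM field `K = Kf i₁ ⊇ i(k)` (`k = Kf i₀` imaginary quadratic), the others the sextic CM fields `K_m = Kf (is' m) ⊇ i'_m(k)`.  `E = A 0 ⊨ (k; {τ})`,
`B = A 1 ⊨ (K; Φ 1)`, `B' = A 2 ⊨ (K; Φ 2)`, `T_m = A (m+3) ⊨ (K_m; Φ (m+3))` with ONE member over `τ`.  A frame `e₁ : Hom(K, ℂ) ≃ Fin 3 × Bool` (sign = «over `τ`»,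
conjugation flips the sign) reads `Φ 1` at the place `0` and `Φ 2` at the place `1` (TWO TYPES OF ONE FIELD, e.g. `B' = B^σ`), and the automorphisms of `ℂ` over `τ(k)` are
`2`-TRANSITIVE on the three `τ`-embeddings of `K` (true for `K = k·F⁺` NOT Galois: `Gal(k·L(F⁺)/k) ≅ 𝔖₃` — gen 14's dihedral frame, the sequel's input).  CROSS conditions
(one `τ`-embedding with one value outside a Galois closure): `K_m` versus `L(K)`, `K` versus `L(K_m)`, `K_m` versus `L(K_{m₀})` (`m₀ ≠ m`) — for sextic fields through `k`:
pairwise `Hom = ∅` (W1 §3).  Then the Hodge conjecture holds for EVERY product of copies `⨁_j A(κ j)` — every `E^a × B^b × B'^c × ∏ T_m^{d_m}` —, GIVEN ONLY Markman's fourfold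
theorem.  PROOF: T2 with frames `Fin.cons e₁ (Fin.cons e₁ e')` (so the realised tuples are DIAGONAL on the twin slots by `mem_realisedTuples`), position sets `{0}, {1}, …`,
cross-unit stabiliser-transitivity from W1's `stabTransitive_realisedTuples_of_outside_prime` (a tuple trivial at slot `0` is trivial at slot `1`), the single-slot Weil spaces from
`weilHyp_of_markman_fourfold_intrinsic`.  This removes, inside one k-group, the restriction «pairwise non-isomorphic fields» of W1/W2 for ONE isomorphic pair: the input the
classes-per-field theorems (`CorCM/MultiFieldWeilTwoPerIsolatedField*`) need to drop «no third threefold over `k`» from «isolated» (the sequel).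
[cite: Markman2025SurveySecant, Thm. 1.2] [cite: Pohlmann1968, Thm 1] [cite: MoonenZarhin1995Duke, Thm. 2.4] [cite: DixonMortimer1996, §1.6, Thm. 1.6A; §2.1]
[cite: Shimura1998, §18.2 Lemma (i)] [cite: Lang2002, VI §1 Thm. 1.1 and Cor. 1.6]

## References
* [Markman2025SurveySecant] E. Markman, arXiv:2509.23403, Thm. 1.2.  [Pohlmann1968] H. Pohlmann, Ann. of Math. 88 (1968), Thm 1.  [MoonenZarhin1995Duke] B. Moonen, Yu. Zarhin,
  Duke Math. J. 77 (1995), Thm. 2.4.  [DixonMortimer1996] J. D. Dixon, B. Mortimer, *Permutation Groups*, GTM 163.  [Shimura1998] G. Shimura, CM book, §18.2.  [Lang2002] S. Lang,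
  *Algebra*, VI §1.
-/

noncomputable section

open CategoryTheory CategoryTheory.Limits NumberField IntermediateField

namespace Summit.HodgeConjecture.CorCM.MultiFieldWeil

open Finset
open Literature.AlgebraicGeometry Literature.AlgebraicGeometry.Motives Literature.AlgebraicGeometry.HodgeTheory
open Literature.AlgebraicGeometry.ComplexMultiplication (IsCMTypeRealisation)
open Literature.AlgebraicTopology.SingularHomology
open Literature.NumberTheory.ComplexMultiplication
open Summit.HodgeConjecture.CorCM.Census.MultiFieldWeil

open scoped Classical

section Twins

variable {I : Type} {r : ℕ} {Kf : I → Type} [∀ i, Field (Kf i)] [∀ i, NumberField (Kf i)] [∀ i, IsCMField (Kf i)]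
  {i₀ i₁ : I} {is' : Fin r → I} {τ : Kf i₀ →+* ℂ}
  {A : Fin (r + 2 + 1) → AbelianVariety ℂ} {Φ : ∀ j : Fin (r + 2 + 1), CMType (Kf (mfSlots i₀ (Fin.cons i₁ (Fin.cons i₁ is') : Fin (r + 2) → I) j))}
  {ι : ∀ j, 𝓞 (Kf (mfSlots i₀ (Fin.cons i₁ (Fin.cons i₁ is') : Fin (r + 2) → I) j)) →+* End (A j)}
  {θ : ∀ j, Kf (mfSlots i₀ (Fin.cons i₁ (Fin.cons i₁ is') : Fin (r + 2) → I) j) →+* Module.End ℂ (complexBetti (A j).X 1)}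

/-- **THE SEXTIC TWIN HEADLINE — `E + B + B' + T_1 + ⋯ + T_r`, TWO TYPES OF ONE FIELD `K ∋ k` AND ANY NUMBER OF FURTHER SEXTIC FIELDS THROUGH `k` OUTSIDE EACH OTHER'S
GALOIS CLOSURES, GIVEN ONLY MARKMAN'S FOURFOLD THEOREM.**  See the module docstring.  `HC_CM` is NOT asserted. [cite: Markman2025SurveySecant, Thm. 1.2] [cite: Pohlmann1968, Thm 1]
[cite: MoonenZarhin1995Duke, Thm. 2.4] [cite: DixonMortimer1996, §1.6, Thm. 1.6A; §2.1] [cite: Shimura1998, §18.2 Lemma (i)] -/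
theorem hodgeConjectureFor_biproduct_comp_of_sexticTwins_of_outside_closures (hW4 : Markman2025_weilClasses_algebraic_abelianFourfold)
    {N : ℕ} (κ : Fin N → Fin (r + 2 + 1)) (h2 : Module.finrank ℚ (Kf i₀) = 2) (h6 : Module.finrank ℚ (Kf i₁) = 6) (h6' : ∀ m : Fin r, Module.finrank ℚ (Kf (is' m)) = 6)
    (i : Kf i₀ →+* Kf i₁) (im' : ∀ m : Fin r, Kf i₀ →+* Kf (is' m)) (hA : ∀ j, IsCMTypeRealisation (Φ j) (A j) (ι j) (θ j))
    (hΨ : ∀ σ : Kf i₀ →+* ℂ, σ ∈ (Φ 0).1 ↔ σ = τ)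
    (e₁ : (Kf i₁ →+* ℂ) ≃ Fin 3 × Bool) (he₁_sign : ∀ s, (e₁ s).2 = true ↔ s.comp i = τ)
    (he₁_conj : ∀ s, e₁ (ComplexEmbedding.conjugate s) = ((e₁ s).1, !(e₁ s).2))
    (h2t₁ : ∀ a a' b b' : Fin 3, a ≠ a' → b ≠ b' → ∃ σ : ℂ ≃+* ℂ, (σ : ℂ →+* ℂ).comp τ = τ ∧
      (σ : ℂ →+* ℂ).comp (e₁.symm (a, true)) = e₁.symm (b, true) ∧ (σ : ℂ →+* ℂ).comp (e₁.symm (a', true)) = e₁.symm (b', true))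
    (hΦ₁ : ∀ s : Kf i₁ →+* ℂ, s ∈ (Φ (Fin.succ 0)).1 ↔ (e₁ s).2 = decide ((e₁ s).1 = 0))
    (hΦ₂ : ∀ s : Kf i₁ →+* ℂ, s ∈ (Φ (Fin.succ 0).succ).1 ↔ (e₁ s).2 = decide ((e₁ s).1 = 1))
    (h1' : ∀ m : Fin r, (Finset.univ.filter fun s : Kf (is' m) →+* ℂ => s.comp (im' m) = τ ∧ s ∈ (Φ m.succ.succ.succ).1).card = 1)
    (houtT : ∀ m : Fin r, ∃ s : Kf (is' m) →+* ℂ, s.comp (im' m) = τ ∧ ∃ x, s x ∉ normalClosure ℚ (Kf i₁) ℂ)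
    (houtT' : ∀ m : Fin r, ∃ s : Kf i₁ →+* ℂ, s.comp i = τ ∧ ∃ x, s x ∉ normalClosure ℚ (Kf (is' m)) ℂ)
    (hout' : ∀ m₀ m : Fin r, m₀ ≠ m → ∃ s : Kf (is' m) →+* ℂ, s.comp (im' m) = τ ∧ ∃ x, s x ∉ normalClosure ℚ (Kf (is' m₀)) ℂ) :
    HodgeConjectureFor (⨁ fun j => A (κ j)).dim (⨁ fun j => A (κ j)).X := by
  -- `δ`, `d` adapted to `τ`
  obtain ⟨δ₀, d, hd, hδ₀⟩ := CyclicSextic.exists_sq_eq_neg_nat_of_isTotallyComplex (Kf i₀) h2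
  obtain ⟨δ, hδ, hτ⟩ := OcticCurveFourfold.exists_delta_of_mem h2 hd hδ₀ τ
  have hττ : ComplexEmbedding.conjugate τ ≠ τ := QuarticCM.conjugate_ne τ
  have hk : ∀ σ : Kf i₀ →+* ℂ, σ = τ ∨ σ = ComplexEmbedding.conjugate τ := fun σ => QuarticCM.eq_or_eq_conjugate_of_quadratic h2 τ σ
  -- frames for the other slots
  have hfr : ∀ m : Fin r, ∃ e : (Kf (is' m) →+* ℂ) ≃ Fin 3 × Bool, (∀ s, (e s).2 = true ↔ s.comp (im' m) = τ) ∧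
      ∀ s, e (ComplexEmbedding.conjugate s) = ((e s).1, !(e s).2) := fun m => exists_signFrame (n := 3) (by rw [h6' m]) h2 (im' m) hττ hk
  choose e' he'_sign he'_conj using hfr
  -- the family data over the slots `Fin (r + 2)`
  let is : Fin (r + 2) → I := Fin.cons i₁ (Fin.cons i₁ is')
  let im : ∀ m : Fin (r + 2), Kf i₀ →+* Kf (is m) := Fin.cons i (Fin.cons i im')
  let e : ∀ m : Fin (r + 2), (Kf (is m) →+* ℂ) ≃ Fin 3 × Bool := Fin.cons e₁ (Fin.cons e₁ e')
  let P : Fin (r + 2) → Finset (Fin 3) :=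
    Fin.cons {0} (Fin.cons {1} fun m => Finset.univ.filter fun a : Fin 3 => (e' m).symm (a, true) ∈ (Φ m.succ.succ.succ).1)
  have he_sign : ∀ (m : Fin (r + 2)) (s : Kf (is m) →+* ℂ), (e m s).2 = true ↔ s.comp (im m) = τ := fun m =>
    Fin.cases he₁_sign (fun m => Fin.cases he₁_sign (fun m => he'_sign m) m) m
  have he_conj : ∀ (m : Fin (r + 2)) (s : Kf (is m) →+* ℂ), e m (ComplexEmbedding.conjugate s) = ((e m s).1, !(e m s).2) := fun m =>
    Fin.cases he₁_conj (fun m => Fin.cases he₁_conj (fun m => he'_conj m) m) m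
  have hΦ : ∀ (m : Fin (r + 2)) (s : Kf (is m) →+* ℂ), s ∈ (Φ m.succ).1 ↔ (e m s).2 = decide ((e m s).1 ∈ P m) := by
    intro m
    refine Fin.cases (fun s => ?_) (fun m => Fin.cases (fun s => ?_) (fun m s => ?_) m) m
    · refine (hΦ₁ s).trans ?_
      show (e₁ s).2 = decide ((e₁ s).1 = 0) ↔ (e₁ s).2 = decide ((e₁ s).1 ∈ ({0} : Finset (Fin 3)))
      simp only [Finset.mem_singleton]
    · refine (hΦ₂ s).trans ?_
      show (e₁ s).2 = decide ((e₁ s).1 = 1) ↔ (e₁ s).2 = decide ((e₁ s).1 ∈ ({1} : Finset (Fin 3)))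
      simp only [Finset.mem_singleton]
    · exact mem_iff_snd_eq_decide_mem_posSet (he'_conj m) (Φ m.succ.succ.succ) s
  have hcard : ∀ m : Fin (r + 2), (P m).card = 1 := by
    intro m
    refine Fin.cases ?_ (fun m => Fin.cases ?_ (fun m => ?_) m) m
    · rfl
    · rfl
    · exact (card_posSet (he'_sign m) (Φ m.succ.succ.succ)).trans (h1' m)
  -- the realised tuples are DIAGONAL on the twin slots
  have hdiag : ∀ π ∈ realisedTuples e τ, ∀ a : Fin 3, Fin.cast rfl (π (Fin.succ 0) a) = π 0 (Fin.cast rfl a) := by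
    intro π hπ a
    obtain ⟨ρ, -, hρ⟩ := (mem_realisedTuples e τ π).1 hπ
    have h0 : (ρ : ℂ →+* ℂ).comp (e₁.symm (a, true)) = e₁.symm (π 0 a, true) := hρ 0 a
    have h1 : (ρ : ℂ →+* ℂ).comp (e₁.symm (a, true)) = e₁.symm (π (Fin.succ 0) a, true) := hρ (Fin.succ 0) a
    have h := (Prod.mk.inj (e₁.symm.injective (h1.symm.trans h0))).1
    exact h
  -- … and `2`-transitive at the slot `0`
  have h2t : ∀ a a' b b' : Fin 3, a ≠ a' → b ≠ b' → ∃ π ∈ realisedTuples e τ, π 0 a = b ∧ π 0 a' = b' := by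
    intro a a' b b' haa hbb
    obtain ⟨σ, hστ, hσa, hσa'⟩ := h2t₁ a a' b b' haa hbb
    obtain ⟨π, hπ, hπσ⟩ := exists_mem_realisedTuples_of_comp_tau_eq (e := e) he_sign σ hστ
    have ha : (σ : ℂ →+* ℂ).comp (e₁.symm (a, true)) = e₁.symm (π 0 a, true) := hπσ 0 a
    have ha' : (σ : ℂ →+* ℂ).comp (e₁.symm (a', true)) = e₁.symm (π 0 a', true) := hπσ 0 a'
    exact ⟨π, hπ, ((Prod.mk.inj (e₁.symm.injective (ha.symm.trans hσa))).1), ((Prod.mk.inj (e₁.symm.injective (ha'.symm.trans hσa'))).1)⟩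
  -- stabiliser-transitivity across units (one value outside a Galois closure, W1)
  have hST : ∀ (m₀ m : Fin (r + 2)), (∃ s : Kf (is m) →+* ℂ, s.comp (im m) = τ ∧ ∃ x, s x ∉ normalClosure ℚ (Kf (is m₀)) ℂ) →
      ∀ a a' : Fin 3, ∃ ν ∈ realisedTuples e τ, ν m₀ = 1 ∧ ν m a = a' := fun m₀ m hout a a' =>
    stabTransitive_realisedTuples_of_outside_prime (e := e) he_sign m₀ m Nat.prime_three hout a a'
  have hstab : ∀ (m₀ m : Fin (r + 2)), (if m₀ = Fin.succ 0 then (0 : Fin (r + 2)) else m₀) ≠ (if m = Fin.succ 0 then (0 : Fin (r + 2)) else m) →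
      ∀ a a' : Fin 3, ∃ ν ∈ realisedTuples e τ, (∀ m', (if m' = Fin.succ 0 then (0 : Fin (r + 2)) else m') = (if m₀ = Fin.succ 0 then (0 : Fin (r + 2)) else m₀) → ν m' = 1) ∧
        ν m a = a' := by
    intro m₀ m hU a a'
    have h10 : (Fin.succ 0 : Fin (r + 2)) ≠ 0 := Fin.succ_ne_zero 0
    -- the unit of `m₀` is the twin pair or a singleton
    by_cases htwin : m₀ = 0 ∨ m₀ = Fin.succ 0
    · -- `m` lies outside the twin pair: `m = m'.succ.succ`
      have hU₀ : (if m₀ = Fin.succ 0 then (0 : Fin (r + 2)) else m₀) = 0 := by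
        rcases htwin with rfl | rfl
        · rw [if_neg h10.symm]
        · rw [if_pos rfl]
      rw [hU₀] at hU
      have hm0 : m ≠ 0 := fun h => hU (by rw [h, if_neg h10.symm])
      have hm1 : m ≠ Fin.succ 0 := fun h => hU (by rw [h, if_pos rfl])
      obtain ⟨m'', rfl⟩ := Fin.exists_succ_eq.2 hm0
      have hm''0 : m'' ≠ 0 := fun h => hm1 (by rw [h])
      obtain ⟨m', rfl⟩ := Fin.exists_succ_eq.2 hm''0
      obtain ⟨ν, hν, hν0, hνa⟩ := hST 0 m'.succ.succ (houtT m') a a'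
      refine ⟨ν, hν, fun m₃ hm₃ => ?_, hνa⟩
      rw [hU₀] at hm₃
      have hν1 : ν (Fin.succ 0) = 1 := by
        ext b
        have hb := hdiag ν hν b
        rw [hν0] at hb
        exact congrArg Fin.val hb
      by_cases h₃ : m₃ = Fin.succ 0
      · rw [h₃]; exact hν1
      · rw [if_neg h₃] at hm₃
        rw [hm₃]; exact hν0
    · -- `m₀ = m₀'.succ.succ` a singleton unit
      push Not at htwin
      obtain ⟨m₀'', rfl⟩ := Fin.exists_succ_eq.2 htwin.1
      have hm₀''0 : m₀'' ≠ 0 := fun h => htwin.2 (by rw [h])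
      obtain ⟨m₀', rfl⟩ := Fin.exists_succ_eq.2 hm₀''0
      have hne1 : (m₀'.succ.succ : Fin (r + 2)) ≠ Fin.succ 0 := htwin.2
      rw [if_neg hne1] at hU
      have hfix : ∀ ν : PermsG (fun _ : Fin (r + 2) => 3), ν m₀'.succ.succ = 1 →
          ∀ m₃, (if m₃ = Fin.succ 0 then (0 : Fin (r + 2)) else m₃) = m₀'.succ.succ → ν m₃ = 1 := by
        intro ν hν m₃ hm₃
        by_cases h₃ : m₃ = Fin.succ 0
        · rw [h₃, if_pos rfl] at hm₃
          exact absurd hm₃.symm (Fin.succ_ne_zero _)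
        · rw [if_neg h₃] at hm₃
          rw [hm₃]; exact hν
      by_cases hm0 : m = 0
      · subst hm0
        obtain ⟨ν, hν, hν0, hνa⟩ := hST m₀'.succ.succ 0 (houtT' m₀') a a'
        exact ⟨ν, hν, hfix ν hν0, hνa⟩
      by_cases hm1 : m = Fin.succ 0
      · subst hm1
        obtain ⟨ν, hν, hν0, hνa⟩ := hST m₀'.succ.succ (Fin.succ 0) (houtT' m₀') a a'
        exact ⟨ν, hν, hfix ν hν0, hνa⟩
      · obtain ⟨m'', rfl⟩ := Fin.exists_succ_eq.2 hm0
        have hm''0 : m'' ≠ 0 := fun h => hm1 (by rw [h])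
        obtain ⟨m', rfl⟩ := Fin.exists_succ_eq.2 hm''0
        rw [if_neg hm1] at hU
        have hne : m₀' ≠ m' := fun h => hU (by rw [h])
        obtain ⟨ν, hν, hν0, hνa⟩ := hST m₀'.succ.succ m'.succ.succ (hout' m₀' m' hne) a a'
        exact ⟨ν, hν, hfix ν hν0, hνa⟩
  -- the one-member counts of the twin slots, for the single-slot Weil spaces
  have hone : ∀ (q : Fin 3) (Ψ : CMType (Kf i₁)), (∀ s : Kf i₁ →+* ℂ, s ∈ Ψ.1 ↔ (e₁ s).2 = decide ((e₁ s).1 = q)) →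
      (Finset.univ.filter fun s : Kf i₁ →+* ℂ => s.comp i = τ ∧ s ∈ Ψ.1).card = 1 := by
    intro q Ψ hΨq
    refine Finset.card_eq_one.2 ⟨e₁.symm (q, true), Finset.ext fun s => ?_⟩
    rw [Finset.mem_filter, Finset.mem_singleton, ← he₁_sign s, hΨq s]
    simp only [Finset.mem_univ, true_and]
    constructor
    · rintro ⟨h2, h1⟩
      rw [h2] at h1
      have h1' : (e₁ s).1 = q := of_decide_eq_true h1.symm
      rw [Equiv.eq_symm_apply]
      exact Prod.ext h1' h2
    · rintro rfl
      rw [Equiv.apply_symm_apply]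
      exact ⟨rfl, by simp⟩
  have h1₁ := hone 0 (Φ (Fin.succ 0)) hΦ₁
  have h1₂ := hone 1 (Φ (Fin.succ 0).succ) hΦ₂
  refine hodgeConjectureFor_biproduct_comp_of_twin_frames (is := is) (n := fun _ => 3) P (fun _ => 1) hcard (fun _ => Nat.prime_three) (fun _ => Nat.one_pos)
    (fun _ => by norm_num) κ h2 im hτ hA e he_sign he_conj hΨ hΦ (m₁ := 0) (m₂ := Fin.succ 0) (Fin.succ_ne_zero 0).symm rfl le_rfl hdiag h2t hstab
    (p₁ := 0) (p₂ := 1) rfl rfl (by decide) fun m => ?_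
  refine Fin.cases ?_ (fun m => Fin.cases ?_ (fun m => ?_) m) m
  · exact weilHyp_of_markman_fourfold_intrinsic hW4 (0 : Fin (r + 2)) h6 h2 hd hδ hA hΨ h1₁
  · exact weilHyp_of_markman_fourfold_intrinsic hW4 (Fin.succ 0 : Fin (r + 2)) h6 h2 hd hδ hA hΨ h1₂
  · exact weilHyp_of_markman_fourfold_intrinsic hW4 (m.succ.succ : Fin (r + 2)) (h6' m) h2 hd hδ hA hΨ (h1' m)


/-! ## §2 The simple form: two NON-ISOGENOUS SIMPLE threefolds over ONE sextic field `K ∋ k`, non-isomorphic further fields -/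

/-- Affine maps `x ↦ ±x + j` of `ℤ/3` are `2`-transitive. [folklore] -/
theorem exists_affine_zmod3 : ∀ a a' b b' : ZMod 3, a ≠ a' → b ≠ b' → ∃ (j : ZMod 3) (f : Bool),
    (if f then -a else a) + j = b ∧ (if f then -a' else a') + j = b' := by
  decide

/-- **THE SEXTIC TWIN HEADLINE, SIMPLE FORM — `E` + two NON-ISOGENOUS SIMPLE CM threefolds `B, B'` over ONE sextic CM field `K ∋ k` + any number of SIMPLE CM threefolds over
sextic CM fields `K_m ∋ k` with `Hom(K_m, K) = ∅` and `Hom(K_m, K_{m₀}) = ∅` (`m₀ ≠ m`): the Hodge conjecture for EVERY product of copies, GIVEN ONLY Markman's fourfold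
theorem.**  Slots `Fin (r+2)` over `Fin.cons i₁ (Fin.cons i₁ is')`; `E = A 0 ⊨ (k; {τ})`; no hypothesis on the types of the threefolds.  PROOF: every threefold structure is
normalised to ONE member over `τ` on the same varieties (`exists_realisations_of_forall_succ`); `K` is not Galois (`SexticCMThreefoldPair.not_isGalois_of_isSimple_of_not_isIsogenous`)
and the two normalised types differ (`cmType_ne_and_ne_compl_of_not_isIsogenous`), so gen 14's dihedral frame `DihedralSexticPair.exists_frame_of_card_fibre_eq_one` reads them at
the places `0`, `1` with the six maps `x ↦ ±x + j` realised (`2`-transitive, `exists_affine_zmod3`); the cross conditions from `Hom = ∅` (W1 §3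
`exists_apply_not_mem_normalClosure_of_isEmpty_ringHom`); then §1.  `HC_CM` is NOT asserted.  NOT covered: a THIRD type of `K` (the face class obstructs), a sister field `k′·K⁺`.
[cite: Markman2025SurveySecant, Thm. 1.2] [cite: Shimura1998, §6.1 Corollary of Theorem 2, §8.2 Prop. 26, §18.2] [cite: Lang2002, VI §1 Thm. 1.14] -/
theorem hodgeConjectureFor_biproduct_comp_of_simpleSexticTwins_of_isEmpty_ringHom (hW4 : Markman2025_weilClasses_algebraic_abelianFourfold)
    {N : ℕ} (κ : Fin N → Fin (r + 2 + 1)) (h2 : Module.finrank ℚ (Kf i₀) = 2) (h6 : Module.finrank ℚ (Kf i₁) = 6) (h6' : ∀ m : Fin r, Module.finrank ℚ (Kf (is' m)) = 6)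
    (i : Kf i₀ →+* Kf i₁) (im' : ∀ m : Fin r, Kf i₀ →+* Kf (is' m)) (hA : ∀ j, IsCMTypeRealisation (Φ j) (A j) (ι j) (θ j))
    (hΨ : ∀ σ : Kf i₀ →+* ℂ, σ ∈ (Φ 0).1 ↔ σ = τ)
    (hS₁ : (A (Fin.succ 0)).IsSimple) (hS₂ : (A (Fin.succ 0).succ).IsSimple) (hni : ¬ AbelianVariety.IsIsogenous (A (Fin.succ 0)) (A (Fin.succ 0).succ))
    (hS' : ∀ m : Fin r, (A m.succ.succ.succ).IsSimple)
    (hisoT : ∀ m : Fin r, IsEmpty (Kf (is' m) →+* Kf i₁)) (hiso' : ∀ m₀ m : Fin r, m₀ ≠ m → IsEmpty (Kf (is' m) →+* Kf (is' m₀))) :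
    HodgeConjectureFor (⨁ fun j => A (κ j)).dim (⨁ fun j => A (κ j)).X := by
  have hττ : ComplexEmbedding.conjugate τ ≠ τ := QuarticCM.conjugate_ne τ
  -- the family data over the slots `Fin (r + 2)`
  let is : Fin (r + 2) → I := Fin.cons i₁ (Fin.cons i₁ is')
  let im : ∀ m : Fin (r + 2), Kf i₀ →+* Kf (is m) := Fin.cons i (Fin.cons i im')
  have h6m : ∀ m : Fin (r + 2), Module.finrank ℚ (Kf (is m)) = 6 := fun m => Fin.cases h6 (fun m => Fin.cases h6 (fun m => h6' m) m) m
  have hSm : ∀ m : Fin (r + 2), (A m.succ).IsSimple := fun m => Fin.cases hS₁ (fun m => Fin.cases hS₂ (fun m => hS' m) m) m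
  -- (1) every threefold structure with ONE member over `τ`, on the same varieties
  obtain ⟨Φ', ι', θ', hA', h0, h1⟩ := exists_realisations_of_forall_succ (is := is) hA
    (fun m Φ' => (Finset.univ.filter fun s : Kf (is m) →+* ℂ => s.comp (im m) = τ ∧ s ∈ Φ'.1).card = 1)
    (fun m => exists_realisation_card_eq_one (h6m m) h2 (im m) (hA m.succ) τ (card_filter_mem_eq_one_or_two_of_isSimple (h6m m) h2 (im m) (hA m.succ) (hSm m) τ))
  have hΨ' : ∀ σ : Kf i₀ →+* ℂ, σ ∈ (Φ' 0).1 ↔ σ = τ := by rw [h0]; exact hΨ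
  -- (2) `K` is not Galois and the two normalised types differ
  have hK : ¬ IsGalois ℚ (Kf i₁) :=
    SexticCMThreefoldPair.not_isGalois_of_isSimple_of_not_isIsogenous h6 h2 i (hA' (Fin.succ 0)) (hA' (Fin.succ 0).succ) hS₁ hS₂ hni
  have hne : (Φ' (Fin.succ 0)).1 ≠ (Φ' (Fin.succ 0).succ).1 :=
    (DihedralSexticPair.cmType_ne_and_ne_compl_of_not_isIsogenous (hA' (Fin.succ 0)) (hA' (Fin.succ 0).succ) hni).1
  -- (3) gen 14's dihedral frame reading both types
  have hdich : ∀ s : Kf i₁ →+* ℂ, s.comp i = τ ∨ s.comp i = ComplexEmbedding.conjugate τ := fun s => QuarticCM.eq_or_eq_conjugate_of_quadratic h2 τ (s.comp i)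
  let Φ₂ : Fin 2 → CMType (Kf i₁) := Fin.cons (Φ' (Fin.succ 0)) fun _ => Φ' (Fin.succ 0).succ
  have hone : ∀ j : Fin 2, (Finset.univ.filter fun s : Kf i₁ →+* ℂ => s.comp i = τ ∧ s ∈ (Φ₂ j).1).card = 1 :=
    Fin.forall_fin_two.2 ⟨h1 0, h1 (Fin.succ 0)⟩
  have hne₂ : (Φ₂ 0).1 ≠ (Φ₂ 1).1 := hne
  obtain ⟨e₁, he_conj, he_sign', he_gal, hΦe⟩ := DihedralSexticPair.exists_frame_of_card_fibre_eq_one hττ hdich hK h6 (Φ := Φ₂) hone hne₂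
  have he₁_sign : ∀ s : Kf i₁ →+* ℂ, (e₁ s).2 = true ↔ s.comp i = τ := fun s => (he_sign' s).symm
  -- (4) `2`-transitivity over `τ`
  have h2t₁ : ∀ a a' b b' : Fin 3, a ≠ a' → b ≠ b' → ∃ σ : ℂ ≃+* ℂ, (σ : ℂ →+* ℂ).comp τ = τ ∧
      (σ : ℂ →+* ℂ).comp (e₁.symm (a, true)) = e₁.symm (b, true) ∧ (σ : ℂ →+* ℂ).comp (e₁.symm (a', true)) = e₁.symm (b', true) := by
    intro a a' b b' haa hbb
    obtain ⟨j, f, hb, hb'⟩ := exists_affine_zmod3 a a' b b' haa hbb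
    obtain ⟨σ, hσ⟩ := he_gal j f
    have hmove : ∀ x : ZMod 3, (σ : ℂ →+* ℂ).comp (e₁.symm (x, true)) = e₁.symm ((if f then -x else x) + j, true) := fun x => by
      have h := hσ (e₁.symm (x, true))
      rw [Equiv.apply_symm_apply] at h
      rw [← h, Equiv.symm_apply_apply]
    refine ⟨σ, ?_, by rw [hmove a, hb], by rw [hmove a', hb']⟩
    -- `σ` fixes `τ`: the `τ`-embedding `e₁⁻¹(0, +)` is carried to a `τ`-embedding
    have hs : (e₁.symm (0, true)).comp i = τ := (he₁_sign _).1 (by rw [Equiv.apply_symm_apply])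
    have hs' : (e₁.symm ((if f then -0 else 0) + j, true)).comp i = τ := (he₁_sign _).1 (by rw [Equiv.apply_symm_apply])
    calc (σ : ℂ →+* ℂ).comp τ = ((σ : ℂ →+* ℂ).comp (e₁.symm (0, true))).comp i := by rw [RingHom.comp_assoc, hs]
      _ = τ := by rw [hmove 0, hs']
  -- (5) the two types at the places `0` and `1`
  have hv0 : ∀ x : ZMod 3, x.val = (0 : Fin 2).val ↔ x = 0 := by decide
  have hv1 : ∀ x : ZMod 3, x.val = (1 : Fin 2).val ↔ x = 1 := by decide
  have hΦ₁ : ∀ s : Kf i₁ →+* ℂ, s ∈ (Φ' (Fin.succ 0)).1 ↔ (e₁ s).2 = decide ((e₁ s).1 = 0) := fun s => by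
    refine (hΦe 0 s).trans ?_
    rw [decide_eq_decide.2 (hv0 _)]
  have hΦ₂ : ∀ s : Kf i₁ →+* ℂ, s ∈ (Φ' (Fin.succ 0).succ).1 ↔ (e₁ s).2 = decide ((e₁ s).1 = 1) := fun s => by
    refine (hΦe 1 s).trans ?_
    rw [decide_eq_decide.2 (hv1 _)]
  -- (6) the cross conditions from `Hom = ∅`
  have hexs : ∀ m : Fin (r + 2), ∃ s : Kf (is m) →+* ℂ, s.comp (im m) = τ := fun m => by
    obtain ⟨s, hs⟩ := Finset.card_pos.1 (by rw [h1 m]; exact Nat.one_pos)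
    exact ⟨s, (Finset.mem_filter.1 hs).2.1⟩
  have hcross : ∀ m₀ m : Fin (r + 2), IsEmpty (Kf (is m) →+* Kf (is m₀)) → ∃ s : Kf (is m) →+* ℂ, s.comp (im m) = τ ∧ ∃ x, s x ∉ normalClosure ℚ (Kf (is m₀)) ℂ :=
    fun m₀ m hK => by
      obtain ⟨s, hs⟩ := hexs m
      exact ⟨s, hs, exists_apply_not_mem_normalClosure_of_isEmpty_ringHom h2 im (h6m m₀) (h6m m) hK s hs⟩
  have hisoT' : ∀ m : Fin r, IsEmpty (Kf i₁ →+* Kf (is' m)) := fun m =>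
    ⟨fun g => by
      have hinj : Function.Injective g.toRatAlgHom.toLinearMap := g.injective
      have hsurj : Function.Surjective g.toRatAlgHom.toLinearMap :=
        (LinearMap.injective_iff_surjective_of_finrank_eq_finrank (h6.trans (h6' m).symm)).1 hinj
      exact (hisoT m).false (AlgEquiv.ofBijective g.toRatAlgHom ⟨hinj, hsurj⟩).symm.toRingEquiv.toRingHom⟩
  exact hodgeConjectureFor_biproduct_comp_of_sexticTwins_of_outside_closures hW4 κ h2 h6 h6' i im' hA' hΨ' e₁ he₁_sign he_conj h2t₁ hΦ₁ hΦ₂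
    (fun m => h1 m.succ.succ) (fun m => hcross 0 m.succ.succ (hisoT m)) (fun m => hcross m.succ.succ 0 (hisoT' m))
    (fun m₀ m hm => hcross m₀.succ.succ m.succ.succ (hiso' m₀ m hm))

/-- **Dominated form.** [cite: Markman2025SurveySecant, Thm. 1.2] [cite: MumfordAV1970, §19 Thm. 1 and p. 169] -/
theorem hodgeConjectureFor_of_avDominatedBy_comp_of_simpleSexticTwins_of_isEmpty_ringHom (hW4 : Markman2025_weilClasses_algebraic_abelianFourfold)
    {N : ℕ} (κ : Fin N → Fin (r + 2 + 1)) (h2 : Module.finrank ℚ (Kf i₀) = 2) (h6 : Module.finrank ℚ (Kf i₁) = 6) (h6' : ∀ m : Fin r, Module.finrank ℚ (Kf (is' m)) = 6)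
    (i : Kf i₀ →+* Kf i₁) (im' : ∀ m : Fin r, Kf i₀ →+* Kf (is' m)) (hA : ∀ j, IsCMTypeRealisation (Φ j) (A j) (ι j) (θ j))
    (hΨ : ∀ σ : Kf i₀ →+* ℂ, σ ∈ (Φ 0).1 ↔ σ = τ)
    (hS₁ : (A (Fin.succ 0)).IsSimple) (hS₂ : (A (Fin.succ 0).succ).IsSimple) (hni : ¬ AbelianVariety.IsIsogenous (A (Fin.succ 0)) (A (Fin.succ 0).succ))
    (hS' : ∀ m : Fin r, (A m.succ.succ.succ).IsSimple)
    (hisoT : ∀ m : Fin r, IsEmpty (Kf (is' m) →+* Kf i₁)) (hiso' : ∀ m₀ m : Fin r, m₀ ≠ m → IsEmpty (Kf (is' m) →+* Kf (is' m₀)))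
    {X : AbelianVariety ℂ} (hX : Domination.AVDominatedBy X (⨁ fun j => A (κ j))) : HodgeConjectureFor X.dim X.X :=
  Domination.hodgeConjectureFor_of_avDominatedBy
    (hodgeConjectureFor_biproduct_comp_of_simpleSexticTwins_of_isEmpty_ringHom hW4 κ h2 h6 h6' i im' hA hΨ hS₁ hS₂ hni hS' hisoT hiso') hX

end Twins

end Summit.HodgeConjecture.CorCM.MultiFieldWeil

end
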